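import Literature.AlgebraicGeometry.Motives.HodgeThetaSubalgebraSymplecticRankSix
import HarnessLib

/-!
# The `Θ`-subalgebra theorem in rank six, PART 2a: the single-eigenvalue case collapses to the E³-type skeleton
# (Moonen–Zarhin 1999 (2.3), Type I(1), `g = 3`)

Family `hodge`, layer `Literature/AlgebraicGeometry/Motives`. Research context: cell `pub-hodge-ring2` (HONEST
FRAMING: research route conditional on HC_CM; not a corollary; Q11.4-sentence-2 already refuted in dim ≥ 3),
Literature lane, programme R13 «generic abelian threefolds», the abstract Lie step, PART 2a. UNCONDITIONAL linear
algebra over `ℂ`; theorems only, no definition, no named fact (D-0026), no `sorry`. Sequel of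
`HodgeThetaSubalgebraSymplecticRankSix` (PART 1: orbit lemma, rank-one criterion, `core_of_rankOne`,
`core_of_twoEigenvalues`).

THE PRINTED THEOREM (target of programme R13). B. Moonen, Yu. Zarhin, *Hodge classes on abelian varieties of low
dimension*, Math. Ann. 315 (1999) 711–733 [`paper:arxiv-math_9901113`, held], §2 (2.3) (p0005 L84–L86):
"`g = 3`. […] Type I(1): `X` is an abelian 3-fold with `End⁰(X) = ℚ`. Then `Hg(X) = Sp(V,φ) ≅ Sp_{6,ℚ}`."

SETTING (as in PART 1). `ω` nondegenerate alternating on a finite-dimensional complex space `M`; `𝔊 ⊆ End(M)`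
bracket-closed and `ω`-skew containing an involution `T` with eigenspaces `P` (`+1`) and `Q` (`−1`); `M` has no
`𝔊`-stable subspace other than `0` and `M`; `𝔊₊ = {B ∈ 𝔊 : B(P) = 0, B(M) ⊆ P}`, `𝔊₋` symmetrically, `𝔊₀`
the elements preserving `P` and `Q`; `dim P = 3`. PART 1 settled the case in which some product `BC|_P`
(`B ∈ 𝔊₊`, `C ∈ 𝔊₋`) has two distinct eigenvalues (`𝔊 = 𝔰𝔭(M, ω)`). This file treats the complementary
SINGLE-EIGENVALUE case `(BC|_P − t)³ = 0`.

WHAT IS PROVED.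
* §1 `SymplecticThetaSix.exists_common_kernel_of_jordanNil` — in dimension three a linear space `𝒩` of operators
  with `N³ = 0` and closed under `N N' + N' N` has a common kernel vector (polarising `(N ± N')³ = 0`; if some
  `N² ≠ 0` the flag `N²w, Nw, w`; if all `N² = 0` the elements anticommute and the image line of one of them is
  killed by all).
* §2 `SymplecticThetaSix.corner_eq_smul_of_singleEigenvalue` — THE COLLAPSE LEMMA: a linear space `𝔈` of operators
  killing `Q` with image in `P`, containing the projection `π` onto `P` along `Q`, closed under `X X' + X' X`,
  each member with a single eigenvalue on `P`, and such that for `Z ∈ 𝔊₀`, `X ∈ 𝔈` the commutator `[Z, X]` lies in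
  `𝔈 + X·𝔈`, is the line `ℂπ`: the trace splits `𝔈 = ℂπ ⊕ 𝔈₀` with `𝔈₀` traceless, hence cube-zero and
  Jordan-closed; the common kernel of `𝔈₀` in `P` is `𝔊₀`-stable (the correction terms `X·Y`, `Y ∈ 𝔈`, kill it and
  the `𝔈`-component of `[Z, X]` is traceless), so it is `0` or `P` by the orbit lemma of PART 1; §1 excludes `0`.
* §3 `SymplecticThetaSix.exists_unit_partner` — from ONE pair with `BC|_P = t + N`, `t ≠ 0`, a partner
  `C₁ = t⁻¹C − t⁻²C(BC − t) + t⁻³C(BC − t)² ∈ 𝔊₋` with `BC₁|_P = 1`; and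
  `SymplecticThetaSix.lines_of_singleEigenvalue` — THE SKELETON THEOREM: in the single-eigenvalue case, given a unit
  pair `B₀C₁|_P = 1`, `𝔊₊ = ℂB₀` and `𝔊₋ = ℂC₁` (§2 for `𝔈 = 𝔊₊C₁` with the identity
  `[Z, B]C₁ = [Z, BC₁] − (BC₁)(B₀[Z, C₁])`, `B₀[Z, C₁] ∈ 𝔊₊C₁`; then §2 for `𝔈 = B₀𝔊₋`, which is
  `ad 𝔊₀`-stable outright once `𝔊₊ = ℂB₀`).

NOT here (PART 2b/3): the all-nilpotent corner (every `BC|_P` nilpotent — excluded by Cartan's criterion applied to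
the trace form of `M` on `[𝔊₊, 𝔊₋]`), the structure `𝔊₀ = ℂT ⊕ 𝔰𝔬₃` of the skeleton, its arithmetic exclusion under
`End_Hdg(V) = ℚ`, Theorem L-Sp in rank six and the abelian threefolds.

## References

* [MoonenZarhin1999LowDim] B. Moonen, Yu. Zarhin, Hodge classes on abelian varieties of low dimension, Math.
  Ann. 315 (1999) 711–733 = arXiv:math/9901113, §2 p. 715, (2.3) Type I(1), (2.4) (1), (2.5).
* [Gordon1997] B. B. Gordon, A survey of the Hodge conjecture for abelian varieties, arXiv:alg-geom/9709030,
  §1.6.2, §6 (proof of Thm. 6.3.3).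
* [Humphreys1972] J. E. Humphreys, Introduction to Lie Algebras and Representation Theory (1972), §3.2–§3.3
  (Engel, linear Lie algebras of nilpotent maps), §4.3 (Cartan's criterion), §19.1.
* [Jacobson1962LieAlgebras] N. Jacobson, Lie Algebras (1962), Ch. II §2–§3 (nil weakly closed sets, Engel–Jacobson).
-/

noncomputable section

namespace Literature.AlgebraicGeometry.Motives

namespace HodgeStructure

/-! ### §1 Jordan-closed spaces of nilpotent operators in dimension three -/

section JordanNil

variable {W : Type*} [AddCommGroup W] [Module ℂ W]

/-- **Common kernel of a Jordan-nil space (dimension three).** Let `W` be a complex space of dimension `3` and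
`𝒩 ⊆ End(W)` a linear subspace with `N³ = 0` for all `N ∈ 𝒩` and `N N' + N' N ∈ 𝒩` for `N, N' ∈ 𝒩`. Then some
`w ≠ 0` is killed by every element of `𝒩`. Proof: polarising `(N ± N')³ = 0` gives
`N²N' + NN'N + N'N² = 0 = NN'² + N'NN' + N'²N`. If some `N² ≠ 0`, take `w` with `u := N²w ≠ 0`; in the basis
`u, Nw, w` the identities force `N'u ∈ ℂu` for every `N' ∈ 𝒩` (using also `N'² ∈ 𝒩`), and `N'u = 0` by
nilpotency. If all `N² = 0` the elements anticommute, so the image line `ℂ N₀x` of one of them is stable under all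
of them, hence killed. (A special case of the Engel–Jacobson theorem for weakly closed nil sets.)
[cite: Jacobson1962LieAlgebras, Ch. II §2 Thm. 1] [cite: Humphreys1972, §3.3] -/
theorem SymplecticThetaSix.exists_common_kernel_of_jordanNil [FiniteDimensional ℂ W]
    (hW : Module.finrank ℂ W = 3) (𝒩 : Submodule ℂ (Module.End ℂ W))
    (hnil : ∀ N ∈ 𝒩, N * N * N = 0) (hJ : ∀ N ∈ 𝒩, ∀ N' ∈ 𝒩, N * N' + N' * N ∈ 𝒩) :
    ∃ w : W, w ≠ 0 ∧ ∀ N ∈ 𝒩, N w = 0 := by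
  classical
  -- polarisation of the cube identity
  have hpol : ∀ N ∈ 𝒩, ∀ N' ∈ 𝒩,
      N * N * N' + N * N' * N + N' * N * N = 0 ∧ N * N' * N' + N' * N * N' + N' * N' * N = 0 := by
    intro N hN N' hN'
    have h1 := hnil _ (add_mem hN hN')
    have h2 := hnil _ (sub_mem hN hN')
    have h3 := hnil N hN
    have h4 := hnil N' hN'
    have e1 : (N + N') * (N + N') * (N + N') = N * N * N + (N * N * N' + N * N' * N + N' * N * N) +
        (N * N' * N' + N' * N * N' + N' * N' * N) + N' * N' * N' := by noncomm_ring
    have e2 : (N - N') * (N - N') * (N - N') = N * N * N - (N * N * N' + N * N' * N + N' * N * N) +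
        (N * N' * N' + N' * N * N' + N' * N' * N) - N' * N' * N' := by noncomm_ring
    rw [e1, h3, h4, zero_add, add_zero] at h1
    rw [e2, h3, h4, zero_sub, sub_zero] at h2
    have hA : N * N' * N' + N' * N * N' + N' * N' * N =
        (2 : ℂ)⁻¹ • ((N * N * N' + N * N' * N + N' * N * N + (N * N' * N' + N' * N * N' + N' * N' * N)) +
          (-(N * N * N' + N * N' * N + N' * N * N) + (N * N' * N' + N' * N * N' + N' * N' * N))) := by
      module
    rw [h1, h2, zero_add, smul_zero] at hA
    rw [hA, add_zero] at h1
    exact ⟨h1, hA⟩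
  -- squares lie in `𝒩`
  have hsq𝒩 : ∀ N ∈ 𝒩, N * N ∈ 𝒩 := by
    intro N hN
    have h := 𝒩.smul_mem (2 : ℂ)⁻¹ (hJ N hN N hN)
    have e : (2 : ℂ)⁻¹ • (N * N + N * N) = N * N := by module
    rwa [e] at h
  -- an eigenvector of a cube-zero operator is killed
  have hkill : ∀ N ∈ 𝒩, ∀ (u : W) (a : ℂ), u ≠ 0 → N u = a • u → N u = 0 := by
    intro N hN u a hu hNu
    have h3 : (N * N * N) u = a ^ 3 • u := by
      simp only [Module.End.mul_apply, hNu, map_smul, smul_smul]; ring_nf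
    rw [hnil N hN, LinearMap.zero_apply] at h3
    have ha : a ^ 3 = 0 := by
      by_contra h
      exact hu ((smul_eq_zero.1 h3.symm).resolve_left h)
    rw [hNu, pow_eq_zero_iff (by norm_num) |>.1 ha, zero_smul]
  by_cases hcase : ∃ N ∈ 𝒩, N * N ≠ 0
  · -- Case (a): some `N² ≠ 0`; flag `u = N²w, Nw, w`
    obtain ⟨N, hN, hNN⟩ := hcase
    obtain ⟨w, hw⟩ : ∃ w, N (N w) ≠ 0 := by
      by_contra! h
      exact hNN (LinearMap.ext fun w => by simpa only [Module.End.mul_apply, LinearMap.zero_apply] using h w)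
    set u := N (N w) with hu
    have hNu : N u = 0 := by
      have h := congrArg (fun f : Module.End ℂ W => f w) (hnil N hN)
      simpa only [Module.End.mul_apply, LinearMap.zero_apply] using h
    have hu0 : u ≠ 0 := hw
    have hN3w : N (N (N w)) = 0 := hNu
    -- every vector is a combination of `u, Nw, w`
    have hli : LinearIndependent ℂ ![u, N w, w] := by
      rw [Fintype.linearIndependent_iff]
      intro g hg
      rw [Fin.sum_univ_three] at hg
      simp only [Matrix.cons_val_zero, Matrix.cons_val_one, Matrix.cons_val_two, Matrix.tail_cons,
        Matrix.head_cons] at hg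
      -- apply `N²`, then `N`
      have hg2 : g 2 = 0 := by
        have h := congrArg (fun x => N (N x)) hg
        simp only [map_add, map_smul, hNu, hN3w, map_zero, smul_zero, zero_add] at h
        exact (smul_eq_zero.1 h).resolve_right hu0
      rw [hg2, zero_smul, add_zero] at hg
      have hg1 : g 1 = 0 := by
        have h := congrArg (fun x => N x) hg
        simp only [map_add, map_smul, hNu, map_zero, smul_zero, zero_add] at h
        exact (smul_eq_zero.1 h).resolve_right hu0
      rw [hg1, zero_smul, add_zero] at hg
      have hg0 : g 0 = 0 := (smul_eq_zero.1 hg).resolve_right hu0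
      intro i
      fin_cases i <;> assumption
    have hspan : ∀ x : W, ∃ a b c : ℂ, x = a • u + b • N w + c • w := by
      intro x
      have htop := hli.span_eq_top_of_card_eq_finrank' (by rw [hW]; simp)
      have hx : x ∈ Submodule.span ℂ (Set.range ![u, N w, w]) := by rw [htop]; exact Submodule.mem_top
      obtain ⟨c, hc⟩ := Submodule.mem_span_range_iff_exists_fun ℂ |>.1 hx
      refine ⟨c 0, c 1, c 2, ?_⟩
      rw [← hc, Fin.sum_univ_three]
      simp
    refine ⟨u, hu0, fun N' hN' => ?_⟩
    obtain ⟨hX, -⟩ := hpol N hN N' hN'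
    obtain ⟨hX3, -⟩ := hpol N hN (N' * N') (hsq𝒩 N' hN')
    obtain ⟨a, b, c, habc⟩ := hspan (N' u)
    obtain ⟨a', b', c', habc'⟩ := hspan (N' (N w))
    -- `N²(N'u) = 0` gives `c = 0`
    have hc : c = 0 := by
      have h := congrArg (fun f : Module.End ℂ W => f u) hX
      simp only [Module.End.mul_apply, LinearMap.add_apply, LinearMap.zero_apply, hNu, map_zero,
        add_zero] at h
      rw [habc] at h
      simp only [map_add, map_smul, hNu, smul_zero, zero_add, hN3w] at h
      exact (smul_eq_zero.1 h).resolve_right hu0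
    rw [hc, zero_smul, add_zero] at habc
    -- `N²(N'(Nw)) + N(N'u) = 0` gives `c' = -b`
    have hc' : c' = -b := by
      have h := congrArg (fun f : Module.End ℂ W => f (N w)) hX
      simp only [Module.End.mul_apply, LinearMap.add_apply, LinearMap.zero_apply, hN3w, map_zero,
        add_zero] at h
      rw [habc', habc] at h
      simp only [map_add, map_smul, hNu, smul_zero, zero_add, hN3w] at h
      rw [← hu, ← add_smul] at h
      have := (smul_eq_zero.1 h).resolve_right hu0
      linear_combination this
    -- `N²(N'²u) = 0` gives `b c' = 0`, so `b = 0`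
    have hb : b = 0 := by
      have h := congrArg (fun f : Module.End ℂ W => f u) hX3
      simp only [Module.End.mul_apply, LinearMap.add_apply, LinearMap.zero_apply, hNu, map_zero,
        add_zero] at h
      rw [habc, map_add, map_smul, map_smul, habc, habc'] at h
      simp only [map_add, map_smul, hNu, smul_zero, zero_add, hN3w, smul_add, smul_smul] at h
      rw [← hu] at h
      have : (b * c') • u = 0 := by
        have e : a • (b • (0 : W)) + (b * a') • (0 : W) + (b * b') • (0 : W) + (b * c') • u = (b * c') • u := by
          simp
        simpa using h
      have hbc := (smul_eq_zero.1 this).resolve_right hu0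
      rw [hc', mul_neg, neg_eq_zero, mul_self_eq_zero] at hbc
      exact hbc
    rw [hb, zero_smul, add_zero] at habc
    exact hkill N' hN' u a hu0 habc
  · -- Case (b): all squares vanish; the elements anticommute
    push Not at hcase
    by_cases h0 : ∃ N₀ ∈ 𝒩, N₀ ≠ 0
    · obtain ⟨N₀, hN₀, hN₀0⟩ := h0
      obtain ⟨x, hx⟩ : ∃ x, N₀ x ≠ 0 := by
        by_contra! h
        exact hN₀0 (LinearMap.ext h)
      refine ⟨N₀ x, hx, fun N' hN' => ?_⟩
      -- `N' N₀ = - N₀ N'`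
      have hanti : N' * N₀ + N₀ * N' = 0 := by
        have h := hcase _ (add_mem hN' hN₀)
        have e : (N' + N₀) * (N' + N₀) = N' * N' + (N' * N₀ + N₀ * N') + N₀ * N₀ := by noncomm_ring
        rwa [e, hcase N' hN', hcase N₀ hN₀, zero_add, add_zero] at h
      -- the image of `N₀` is the line through `N₀ x`
      have hrange : LinearMap.range N₀ = ℂ ∙ N₀ x := by
        have hker : LinearMap.range N₀ ≤ LinearMap.ker N₀ := by
          rintro _ ⟨y, rfl⟩
          rw [LinearMap.mem_ker]
          have h := congrArg (fun f : Module.End ℂ W => f y) (hcase N₀ hN₀)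
          simpa only [Module.End.mul_apply, LinearMap.zero_apply] using h
        have h1 := LinearMap.finrank_range_add_finrank_ker N₀
        have h2 := Submodule.finrank_mono hker
        have h3 : Module.finrank ℂ (LinearMap.range N₀) ≤ 1 := by rw [hW] at h1; omega
        have hle : (ℂ ∙ N₀ x) ≤ LinearMap.range N₀ := by
          rw [Submodule.span_singleton_le_iff_mem]; exact ⟨x, rfl⟩
        exact (Submodule.eq_of_le_of_finrank_le hle (by rw [finrank_span_singleton hx]; exact h3)).symm
      have hmem : N' (N₀ x) ∈ ℂ ∙ N₀ x := by
        have h := congrArg (fun f : Module.End ℂ W => f x) hanti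
        simp only [LinearMap.add_apply, Module.End.mul_apply, LinearMap.zero_apply] at h
        rw [eq_neg_of_add_eq_zero_left h, ← hrange]
        exact Submodule.neg_mem _ ⟨N' x, rfl⟩
      obtain ⟨a, ha⟩ := Submodule.mem_span_singleton.1 hmem
      exact hkill N' hN' (N₀ x) a hx ha.symm
    · push Not at h0
      obtain ⟨w, hw⟩ := (Module.finrank_pos_iff_exists_ne_zero (R := ℂ) (M := W)).1 (by rw [hW]; norm_num)
      exact ⟨w, hw, fun N hN => by rw [h0 N hN, LinearMap.zero_apply]⟩

end JordanNil

/-! ### §2 The collapse lemma: a unital Jordan-closed corner space with single eigenvalues is the line `ℂπ` -/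

section Collapse

variable {M : Type*} [AddCommGroup M] [Module ℂ M]

/-- **The collapse lemma.** Let `𝔊 ⊆ End(M)` be bracket-closed with an involution `T ∈ 𝔊` (eigenspaces `P`, `Q`,
`dim P = 3`) and no `𝔊`-stable subspaces other than `0`, `M`. Let `𝔈 ⊆ End(M)` be a linear space of operators
killing `Q` with image in `P`, containing the projection `π` onto `P` along `Q`, closed under `X X' + X' X`,
each member having a single eigenvalue on `P` (`(X − t)³ = 0` on `P`), and such that for every `Z ∈ 𝔊`
preserving `P` and `Q` and every `X ∈ 𝔈` there is `Y ∈ 𝔈` with `[Z, X] − X Y ∈ 𝔈`. Then every `X ∈ 𝔈` equals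
`(tr X / 3) π`. Proof: `tr X = 3t`, so `𝔈 = ℂπ ⊕ 𝔈₀` with `𝔈₀ = 𝔈 ∩ ker tr` consisting of cube-zero
operators, Jordan-closed (`tr(n n') = 0` by polarisation); the common kernel `K ⊆ P` of `𝔈₀` is stable under
`𝔊₀`: `n(Zk) = −[Z, n]k = −(σ + nY)k` with `σ ∈ 𝔈` traceless and `Y ∈ ℂπ + 𝔈₀`; by the orbit lemma
(`SymplecticThetaSix.eq_bot_or_eq_of_stable_le`) `K = P` (so `𝔈₀ = 0`) or `K = 0`, and the latter contradicts
§1 applied to the restrictions to `P`. (The E³-type mechanism behind Moonen–Zarhin (2.3)/(2.5).)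
[cite: MoonenZarhin1999LowDim, §2 (2.3), (2.5)] [cite: Jacobson1962LieAlgebras, Ch. II §2] -/
theorem SymplecticThetaSix.corner_eq_smul_of_singleEigenvalue [FiniteDimensional ℂ M]
    (𝔊 : Submodule ℂ (Module.End ℂ M))
    (hbr : ∀ Y ∈ 𝔊, ∀ Z ∈ 𝔊, Y * Z - Z * Y ∈ 𝔊) {T : Module.End ℂ M} (hT𝔊 : T ∈ 𝔊) (hTT : ∀ v, T (T v) = v)
    {P Q : Submodule ℂ M} (hP : ∀ x ∈ P, T x = x) (hQ : ∀ x ∈ Q, T x = -x)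
    (hPmem : ∀ v, (2 : ℂ)⁻¹ • (v + T v) ∈ P) (hQmem : ∀ v, (2 : ℂ)⁻¹ • (v - T v) ∈ Q)
    (hirr : ∀ U : Submodule ℂ M, (∀ Z ∈ 𝔊, ∀ u ∈ U, Z u ∈ U) → U = ⊥ ∨ U = ⊤)
    (hP3 : Module.finrank ℂ ↥P = 3)
    (𝔈 : Submodule ℂ (Module.End ℂ M)) {π : Module.End ℂ M} (hπ𝔈 : π ∈ 𝔈) (hπP : ∀ p ∈ P, π p = p)
    (h𝔈Q : ∀ X ∈ 𝔈, ∀ q ∈ Q, X q = 0) (h𝔈P : ∀ X ∈ 𝔈, ∀ v, X v ∈ P)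
    (hJ : ∀ X ∈ 𝔈, ∀ X' ∈ 𝔈, X * X' + X' * X ∈ 𝔈)
    (hsingle : ∀ X ∈ 𝔈, ∃ t : ℂ, ∀ p ∈ P, ((X - t • 1) ^ 3 : Module.End ℂ M) p = 0)
    (had : ∀ Z ∈ 𝔊, (∀ p ∈ P, Z p ∈ P) → (∀ q ∈ Q, Z q ∈ Q) → ∀ X ∈ 𝔈,
      ∃ Y ∈ 𝔈, Z * X - X * Z - X * Y ∈ 𝔈) :
    ∀ X ∈ 𝔈, X = ((3 : ℂ)⁻¹ * LinearMap.trace ℂ M X) • π := by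
  classical
  -- `P ∩ Q = 0` and `v = v₊ + v₋`
  have hPQ : ∀ x ∈ P, x ∈ Q → x = 0 := fun x hxP hxQ => by
    have h1 := hP x hxP
    have h2 := hQ x hxQ
    rw [h1] at h2
    have h3 : (2 : ℂ) • x = 0 := by
      rw [two_smul]
      nth_rewrite 2 [h2]
      exact add_neg_cancel x
    exact (smul_eq_zero.1 h3).resolve_left two_ne_zero
  have hsplit : ∀ v : M, ∃ p ∈ P, ∃ q ∈ Q, v = p + q := fun v =>
    ⟨_, hPmem v, _, hQmem v, by module⟩
  have hπim : ∀ v, π v ∈ P := h𝔈P π hπ𝔈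
  have hπQ : ∀ q ∈ Q, π q = 0 := h𝔈Q π hπ𝔈
  have hXπ : ∀ X ∈ 𝔈, X * π = X := fun X hX => by
    ext v
    obtain ⟨p, hp, q, hq, rfl⟩ := hsplit v
    rw [Module.End.mul_apply, map_add π, hπP p hp, hπQ q hq, add_zero, map_add X, h𝔈Q X hX q hq, add_zero]
  -- the cube of `X - t π` vanishes on all of `M`
  have hcube : ∀ X ∈ 𝔈, ∀ t : ℂ, (∀ p ∈ P, ((X - t • 1) ^ 3 : Module.End ℂ M) p = 0) →
      (X - t • π) * (X - t • π) * (X - t • π) = 0 := by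
    intro X hX t ht
    have hNP : ∀ y ∈ P, (X - t • π) y = (X - t • 1) y ∧ (X - t • 1) y ∈ P := fun y hy => by
      refine ⟨?_, ?_⟩
      · simp only [LinearMap.sub_apply, LinearMap.smul_apply, hπP y hy, Module.End.one_apply]
      · simp only [LinearMap.sub_apply, LinearMap.smul_apply, Module.End.one_apply]
        exact sub_mem (h𝔈P X hX y) (P.smul_mem t hy)
    have hNQ : ∀ q ∈ Q, (X - t • π) q = 0 := fun q hq => by
      simp only [LinearMap.sub_apply, LinearMap.smul_apply, hπQ q hq, h𝔈Q X hX q hq, smul_zero, sub_zero]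
    ext v
    obtain ⟨p, hp, q, hq, rfl⟩ := hsplit v
    have h1 := hNP p hp
    have h2 := hNP _ h1.2
    have h3 := hNP _ h2.2
    rw [LinearMap.zero_apply, Module.End.mul_apply, Module.End.mul_apply, map_add, hNQ q hq, add_zero,
      h1.1, h2.1, h3.1]
    have h := ht p hp
    rwa [pow_three, Module.End.mul_apply, Module.End.mul_apply] at h
  -- traces
  have htr0 : ∀ N : Module.End ℂ M, N * N * N = 0 → LinearMap.trace ℂ M N = 0 := fun N hN =>
    (LinearMap.isNilpotent_trace_of_isNilpotent ⟨3, by rw [pow_three', hN]⟩).eq_zero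
  have htrπ : LinearMap.trace ℂ M π = 3 := by
    have hproj : LinearMap.IsProj P π := ⟨hπim, hπP⟩
    rw [hproj.trace, hP3]
    norm_num
  have hcube' : ∀ X ∈ 𝔈, (X - ((3 : ℂ)⁻¹ * LinearMap.trace ℂ M X) • π) *
      (X - ((3 : ℂ)⁻¹ * LinearMap.trace ℂ M X) • π) * (X - ((3 : ℂ)⁻¹ * LinearMap.trace ℂ M X) • π) = 0 := by
    intro X hX
    obtain ⟨t, ht⟩ := hsingle X hX
    have h := hcube X hX t ht
    have htr : LinearMap.trace ℂ M X = 3 * t := by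
      have h0 := htr0 _ h
      rw [map_sub, map_smul, htrπ, smul_eq_mul, sub_eq_zero] at h0
      rw [h0]
      ring
    have e : (3 : ℂ)⁻¹ * LinearMap.trace ℂ M X = t := by
      rw [htr]
      ring
    rwa [e]
  -- the traceless part `𝔈₀`
  set 𝔈₀ : Submodule ℂ (Module.End ℂ M) := 𝔈 ⊓ LinearMap.ker (LinearMap.trace ℂ M) with h𝔈₀
  have hmem₀ : ∀ X, X ∈ 𝔈₀ ↔ X ∈ 𝔈 ∧ LinearMap.trace ℂ M X = 0 := fun X => by
    rw [h𝔈₀, Submodule.mem_inf, LinearMap.mem_ker]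
  have hcube₀ : ∀ n ∈ 𝔈₀, n * n * n = 0 := fun n hn => by
    obtain ⟨hn𝔈, htr⟩ := (hmem₀ n).1 hn
    have h := hcube' n hn𝔈
    rwa [htr, mul_zero, zero_smul, sub_zero] at h
  have hdecomp : ∀ Y ∈ 𝔈, Y - ((3 : ℂ)⁻¹ * LinearMap.trace ℂ M Y) • π ∈ 𝔈₀ := fun Y hY => by
    rw [hmem₀]
    refine ⟨sub_mem hY (𝔈.smul_mem _ hπ𝔈), ?_⟩
    rw [map_sub, map_smul, htrπ, smul_eq_mul]
    ring
  have htrsq : ∀ n ∈ 𝔈₀, LinearMap.trace ℂ M (n * n) = 0 := fun n hn => htr0 _ (by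
    rw [show n * n * (n * n) * (n * n) = (n * n * n) * (n * n * n) by noncomm_ring, hcube₀ n hn, zero_mul])
  have htrmul : ∀ n ∈ 𝔈₀, ∀ n' ∈ 𝔈₀, LinearMap.trace ℂ M (n * n') = 0 := fun n hn n' hn' => by
    have h := htrsq _ (add_mem hn hn')
    rw [show (n + n') * (n + n') = n * n + n * n' + n' * n + n' * n' by noncomm_ring, map_add, map_add,
      map_add, htrsq n hn, htrsq n' hn', LinearMap.trace_mul_comm ℂ n' n] at h
    linear_combination h / 2
  have hJ₀ : ∀ n ∈ 𝔈₀, ∀ n' ∈ 𝔈₀, n * n' + n' * n ∈ 𝔈₀ := fun n hn n' hn' => by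
    rw [hmem₀]
    refine ⟨hJ n ((hmem₀ n).1 hn).1 n' ((hmem₀ n').1 hn').1, ?_⟩
    rw [map_add, htrmul n hn n' hn', LinearMap.trace_mul_comm ℂ n' n, htrmul n hn n' hn', add_zero]
  -- the common kernel `K ⊆ P` of `𝔈₀` is `𝔊₀`-stable
  set K : Submodule ℂ M := P ⊓ ⨅ n : ↥𝔈₀, LinearMap.ker (n : Module.End ℂ M) with hK
  have hmemK : ∀ v, v ∈ K ↔ v ∈ P ∧ ∀ n ∈ 𝔈₀, n v = 0 := fun v => by
    simp only [hK, Submodule.mem_inf, Submodule.mem_iInf, LinearMap.mem_ker, Subtype.forall]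
  have hKP : K ≤ P := inf_le_left
  have hKstab : ∀ Z ∈ 𝔊, (∀ p ∈ P, Z p ∈ P) → ∀ k ∈ K, Z k ∈ K := by
    intro Z hZ hZP k hk
    obtain ⟨hkP, hkn⟩ := (hmemK k).1 hk
    obtain ⟨Zm, -, Z0, hZ0, Zp, -, hZeq, hZpP, -, -, hZmim, -, -, hZ0P, hZ0Q⟩ :=
      SymplecticTheta.exists_decomp 𝔊 hbr hT𝔊 hTT hP hQ hPmem hQmem hZ
    have hZk : Z k = Z0 k := by
      have h1 : Z k = Zm k + Z0 k := by
        rw [hZeq, LinearMap.add_apply, LinearMap.add_apply, hZpP k hkP, add_zero]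
      have hZmk : Zm k = 0 := hPQ _ (by
        have h2 : Zm k = Z k - Z0 k := by rw [h1]; abel
        rw [h2]
        exact sub_mem (hZP k hkP) (hZ0P k hkP)) (hZmim k)
      rw [h1, hZmk, zero_add]
    rw [hZk, hmemK]
    refine ⟨hZ0P k hkP, fun n hn => ?_⟩
    obtain ⟨hn𝔈, hntr⟩ := (hmem₀ n).1 hn
    obtain ⟨Y, hY, hσ⟩ := had Z0 hZ0 hZ0P hZ0Q n hn𝔈
    have hn' := hdecomp Y hY
    have hnY : n * Y = ((3 : ℂ)⁻¹ * LinearMap.trace ℂ M Y) • n +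
        n * (Y - ((3 : ℂ)⁻¹ * LinearMap.trace ℂ M Y) • π) := by
      rw [mul_sub, mul_smul_comm, hXπ n hn𝔈]
      abel
    have hσ₀ : Z0 * n - n * Z0 - n * Y ∈ 𝔈₀ := by
      rw [hmem₀]
      refine ⟨hσ, ?_⟩
      rw [map_sub, map_sub, LinearMap.trace_mul_comm ℂ Z0 n, sub_self, zero_sub, neg_eq_zero, hnY, map_add,
        map_smul, hntr, smul_zero, zero_add, htrmul n hn _ hn']
    have h1 : (Z0 * n - n * Z0 - n * Y) k = 0 := hkn _ hσ₀
    have h2 : (n * Y) k = 0 := by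
      rw [hnY, LinearMap.add_apply, LinearMap.smul_apply, Module.End.mul_apply, hkn n hn, hkn _ hn', map_zero,
        smul_zero, add_zero]
    rw [LinearMap.sub_apply, LinearMap.sub_apply, Module.End.mul_apply, Module.End.mul_apply, hkn n hn, map_zero,
      zero_sub, h2, sub_zero, neg_eq_zero] at h1
    exact h1
  have hK' := SymplecticThetaSix.eq_bot_or_eq_of_stable_le 𝔊 hbr hT𝔊 hTT hP hQ hPmem hQmem hirr K hKP hKstab
  -- hence `𝔈₀ = 0`
  have h𝔈₀ : ∀ n ∈ 𝔈₀, n = 0 := by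
    rcases hK' with hbot | htop
    · -- `K = 0` contradicts §1 for the restrictions to `P`
      let ρ : Module.End ℂ M →ₗ[ℂ] Module.End ℂ ↥P :=
        { toFun := fun X => (π ∘ₗ X ∘ₗ P.subtype).codRestrict P fun p => hπim _
          map_add' := fun X X' => by ext p; simp
          map_smul' := fun a X => by ext p; simp }
      have hρapply : ∀ (X : Module.End ℂ M) (p : ↥P), ((ρ X p : ↥P) : M) = π (X p) := fun X p => rfl
      have hρmul : ∀ X X' : Module.End ℂ M, (∀ v, X' v ∈ P) → ρ (X * X') = ρ X * ρ X' :=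
        fun X X' hX' => by
          ext p
          simp only [Module.End.mul_apply, hρapply, hπP _ (hX' _)]
      obtain ⟨w, hw0, hw⟩ := SymplecticThetaSix.exists_common_kernel_of_jordanNil hP3 (𝔈₀.map ρ)
        (fun N hN => by
          obtain ⟨n, hn, rfl⟩ := Submodule.mem_map.1 hN
          have hnP := h𝔈P n ((hmem₀ n).1 hn).1
          rw [← hρmul n n hnP, ← hρmul (n * n) n hnP, hcube₀ n hn, map_zero])
        (fun N hN N' hN' => by
          obtain ⟨n, hn, rfl⟩ := Submodule.mem_map.1 hN
          obtain ⟨n', hn', rfl⟩ := Submodule.mem_map.1 hN'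
          rw [← hρmul n n' (h𝔈P n' ((hmem₀ n').1 hn').1), ← hρmul n' n (h𝔈P n ((hmem₀ n).1 hn).1),
            ← map_add]
          exact Submodule.mem_map_of_mem (hJ₀ n hn n' hn'))
      exfalso
      apply hw0
      have hwK : (w : M) ∈ K := by
        rw [hmemK]
        refine ⟨w.2, fun n hn => ?_⟩
        have h := congrArg Subtype.val (hw (ρ n) (Submodule.mem_map_of_mem hn))
        rw [hρapply, hπP _ (h𝔈P n ((hmem₀ n).1 hn).1 _)] at h
        exact h
      rw [hbot, Submodule.mem_bot] at hwK
      exact Subtype.ext hwK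
    · intro n hn
      ext v
      obtain ⟨p, hp, q, hq, rfl⟩ := hsplit v
      have hpK : p ∈ K := by rw [htop]; exact hp
      rw [map_add, ((hmemK p).1 hpK).2 n hn, h𝔈Q n ((hmem₀ n).1 hn).1 q hq, add_zero, LinearMap.zero_apply]
  intro X hX
  exact sub_eq_zero.1 (h𝔈₀ _ (hdecomp X hX))

end Collapse

/-! ### §3 Unit partners and the skeleton theorem -/

section Skeleton

variable {M : Type*} [AddCommGroup M] [Module ℂ M]

/-- **A unit partner.** Let `ω` be nondegenerate alternating, `𝔊` bracket-closed and `ω`-skew containing the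
involution `T` (eigenspaces `P`, `Q`). If `B ∈ 𝔊₊`, `C ∈ 𝔊₋` have `(BC − t)³ = 0` on `P` with `t ≠ 0`, then
`C₁ := t⁻³ (t²C − t(CBC − tC) + (CBCBC − 2t CBC + t²C)) ∈ 𝔊₋` satisfies `BC₁ = 1` on `P` and `C₁B = 1` on `Q`
(`CBC = ½(ad C)²... ∈ 𝔊₋` by the Jordan identity `CBC' + C'BC = −[[B,C],C']`; on `P`,
`BC₁ = t⁻³((BC − t)³ + t³)`; the relation on `Q` is dual to the one on `P` under `ω`, `Q` being isotropic).
[cite: MoonenZarhin1999LowDim, §2 (2.3)] [cite: GoodmanWallachGTM255, §2.1.2] -/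
theorem SymplecticThetaSix.exists_unit_partner (ω : LinearMap.BilinForm ℂ M) (hωnd : ω.Nondegenerate)
    (𝔊 : Submodule ℂ (Module.End ℂ M))
    (hbr : ∀ Y ∈ 𝔊, ∀ Z ∈ 𝔊, Y * Z - Z * Y ∈ 𝔊) (hskew : ∀ Z ∈ 𝔊, ∀ x y, ω (Z x) y + ω x (Z y) = 0)
    {T : Module.End ℂ M} (hT𝔊 : T ∈ 𝔊) {P Q : Submodule ℂ M} (hQ : ∀ x ∈ Q, T x = -x)
    (hPmem : ∀ v, (2 : ℂ)⁻¹ • (v + T v) ∈ P) (hQmem : ∀ v, (2 : ℂ)⁻¹ • (v - T v) ∈ Q)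
    {B C : Module.End ℂ M} (hB𝔊 : B ∈ 𝔊)
    (hC𝔊 : C ∈ 𝔊) (hCQ : ∀ q ∈ Q, C q = 0) (hCim : ∀ v, C v ∈ Q)
    {t : ℂ} (ht : t ≠ 0) (hN : ∀ p ∈ P, ((B * C - t • 1) ^ 3 : Module.End ℂ M) p = 0) :
    ∃ C₁ ∈ 𝔊, (∀ q ∈ Q, C₁ q = 0) ∧ (∀ v, C₁ v ∈ Q) ∧ (∀ p ∈ P, B (C₁ p) = p) ∧
      (∀ q ∈ Q, C₁ (B q) = q) := by
  classical
  have hsplit : ∀ v : M, ∃ p ∈ P, ∃ q ∈ Q, v = p + q := fun v =>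
    ⟨_, hPmem v, _, hQmem v, by module⟩
  -- the Jordan identity `C B C' + C' B C = -[[B, C], C'] ∈ 𝔊₋`
  have hjordan : ∀ C' ∈ 𝔊, (∀ q ∈ Q, C' q = 0) → (∀ v, C' v ∈ Q) →
      C * B * C' + C' * B * C ∈ 𝔊 ∧ (∀ q ∈ Q, (C * B * C' + C' * B * C) q = 0) ∧
        (∀ v, (C * B * C' + C' * B * C) v ∈ Q) := by
    intro C' hC' hC'Q hC'im
    have hCC' : C * C' = 0 := by ext v; exact hCQ _ (hC'im v)
    have hC'C : C' * C = 0 := by ext v; exact hC'Q _ (hCim v)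
    have e : C * B * C' + C' * B * C = -((B * C - C * B) * C' - C' * (B * C - C * B)) := by
      rw [show (B * C - C * B) * C' - C' * (B * C - C * B) = B * (C * C') - C * B * C' - C' * B * C + C' * C * B
        by noncomm_ring, hCC', hC'C]
      noncomm_ring
    refine ⟨?_, fun q hq => ?_, fun v => ?_⟩
    · rw [e]; exact Submodule.neg_mem _ (hbr _ (hbr B hB𝔊 C hC𝔊) C' hC')
    · rw [LinearMap.add_apply, Module.End.mul_apply, Module.End.mul_apply, hC'Q q hq, map_zero, map_zero,
        Module.End.mul_apply, Module.End.mul_apply, hCQ q hq, map_zero, map_zero, add_zero]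
    · rw [LinearMap.add_apply, Module.End.mul_apply, Module.End.mul_apply, Module.End.mul_apply,
        Module.End.mul_apply]
      exact add_mem (hCim _) (hC'im _)
  obtain ⟨hCBC𝔊', hCBCQ', hCBCim'⟩ := hjordan C hC𝔊 hCQ hCim
  have hCBC : C * B * C ∈ 𝔊 ∧ (∀ q ∈ Q, (C * B * C) q = 0) ∧ (∀ v, (C * B * C) v ∈ Q) := by
    have e : C * B * C = (2 : ℂ)⁻¹ • (C * B * C + C * B * C) := by module
    refine ⟨by rw [e]; exact 𝔊.smul_mem _ hCBC𝔊', fun q hq => ?_, fun v => ?_⟩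
    · rw [e, LinearMap.smul_apply, hCBCQ' q hq, smul_zero]
    · rw [e, LinearMap.smul_apply]; exact Q.smul_mem _ (hCBCim' v)
  obtain ⟨h5𝔊', h5Q', h5im'⟩ := hjordan (C * B * C) hCBC.1 hCBC.2.1 hCBC.2.2
  have h5 : C * B * C * B * C ∈ 𝔊 ∧ (∀ q ∈ Q, (C * B * C * B * C) q = 0) ∧
      (∀ v, (C * B * C * B * C) v ∈ Q) := by
    have e : C * B * C * B * C = (2 : ℂ)⁻¹ • (C * B * (C * B * C) + C * B * C * B * C) := by
      rw [show C * B * (C * B * C) = C * B * C * B * C by noncomm_ring]; module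
    refine ⟨by rw [e]; exact 𝔊.smul_mem _ h5𝔊', fun q hq => ?_, fun v => ?_⟩
    · rw [e, LinearMap.smul_apply, h5Q' q hq, smul_zero]
    · rw [e, LinearMap.smul_apply]; exact Q.smul_mem _ (h5im' v)
  -- the partner
  set C₁' : Module.End ℂ M := t ^ 2 • C - t • (C * B * C - t • C) +
    (C * B * C * B * C - (2 * t) • (C * B * C) + t ^ 2 • C) with hC₁'
  have hC₁'𝔊 : C₁' ∈ 𝔊 := by
    refine add_mem (sub_mem (𝔊.smul_mem _ hC𝔊) (𝔊.smul_mem _ (sub_mem hCBC.1 (𝔊.smul_mem _ hC𝔊)))) ?_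
    exact add_mem (sub_mem h5.1 (𝔊.smul_mem _ hCBC.1)) (𝔊.smul_mem _ hC𝔊)
  have hC₁'Q : ∀ q ∈ Q, C₁' q = 0 := fun q hq => by
    simp only [hC₁', LinearMap.add_apply, LinearMap.sub_apply, LinearMap.smul_apply, hCQ q hq, hCBC.2.1 q hq,
      h5.2.1 q hq, smul_zero, sub_zero, add_zero]
  have hC₁'im : ∀ v, C₁' v ∈ Q := fun v => by
    simp only [hC₁', LinearMap.add_apply, LinearMap.sub_apply, LinearMap.smul_apply]
    refine add_mem (sub_mem (Q.smul_mem _ (hCim v)) (Q.smul_mem _ (sub_mem (hCBC.2.2 v)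
      (Q.smul_mem _ (hCim v))))) ?_
    exact add_mem (sub_mem (h5.2.2 v) (Q.smul_mem _ (hCBC.2.2 v))) (Q.smul_mem _ (hCim v))
  have hBC₁' : ∀ p ∈ P, B (C₁' p) = ((B * C - t • 1) ^ 3 : Module.End ℂ M) p + t ^ 3 • p := fun p _ => by
    simp only [hC₁', pow_three, LinearMap.add_apply, LinearMap.sub_apply, LinearMap.smul_apply,
      Module.End.mul_apply, Module.End.one_apply, map_add, map_sub, map_smul]
    module
  refine ⟨(t⁻¹) ^ 3 • C₁', 𝔊.smul_mem _ hC₁'𝔊, fun q hq => by rw [LinearMap.smul_apply, hC₁'Q q hq, smul_zero],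
    fun v => by rw [LinearMap.smul_apply]; exact Q.smul_mem _ (hC₁'im v), fun p hp => ?_, fun q hq => ?_⟩
  · rw [LinearMap.smul_apply, map_smul, hBC₁' p hp, hN p hp, zero_add, smul_smul, ← mul_pow,
      inv_mul_cancel₀ ht, one_pow, one_smul]
  · -- duality: `ω(C₁ B q - q, v) = 0` for all `v`
    have hBC₁ : ∀ p ∈ P, B (((t⁻¹) ^ 3 • C₁') p) = p := fun p hp => by
      rw [LinearMap.smul_apply, map_smul, hBC₁' p hp, hN p hp, zero_add, smul_smul, ← mul_pow,
        inv_mul_cancel₀ ht, one_pow, one_smul]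
    set C₁ := (t⁻¹) ^ 3 • C₁' with hC₁def
    have hC₁𝔊 : C₁ ∈ 𝔊 := 𝔊.smul_mem _ hC₁'𝔊
    have hC₁im : ∀ v, C₁ v ∈ Q := fun v => by rw [hC₁def, LinearMap.smul_apply]; exact Q.smul_mem _ (hC₁'im v)
    have hQQ : ∀ a ∈ Q, ∀ b ∈ Q, ω a b = 0 := fun a ha b hb => by
      have h := hskew T hT𝔊 a b
      rw [hQ a ha, hQ b hb, map_neg, LinearMap.neg_apply, map_neg] at h
      have h2 : (2 : ℂ) * ω a b = 0 := by linear_combination -h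
      exact (mul_eq_zero.1 h2).resolve_left two_ne_zero
    have hy : C₁ (B q) - q ∈ Q := sub_mem (hC₁im _) hq
    rw [← sub_eq_zero]
    refine hωnd.1 _ fun v => ?_
    obtain ⟨p, hp, q', hq', rfl⟩ := hsplit v
    rw [map_add, hQQ _ hy _ hq', add_zero, map_sub, LinearMap.sub_apply]
    have h1 := hskew C₁ hC₁𝔊 (B q) p
    have h2 := hskew B hB𝔊 q (C₁ p)
    rw [hBC₁ p hp] at h2
    linear_combination h1 - h2

/-- **The skeleton theorem (single-eigenvalue case).** Let `𝔊 ⊆ End(M)` be bracket-closed with an involution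
`T ∈ 𝔊` (eigenspaces `P`, `Q`, `dim P = 3`) and no `𝔊`-stable subspaces other than `0`, `M`; suppose that every
product `BC` (`B ∈ 𝔊₊`, `C ∈ 𝔊₋`) has a single eigenvalue on `P`, and that `B₀ ∈ 𝔊₊`, `C₁ ∈ 𝔊₋` form a unit
pair (`B₀C₁ = 1` on `P`, `C₁B₀ = 1` on `Q`). Then `𝔊₊ = ℂB₀` and `𝔊₋ = ℂC₁`; precisely
`B = (tr(BC₁)/3) B₀` and `C = (tr(B₀C)/3) C₁`. Proof: the collapse lemma (§2) for `𝔈 = 𝔊₊C₁` (with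
`π = B₀C₁`, the Jordan identity `(BC₁)(B'C₁) + (B'C₁)(BC₁) = (BC₁B' + B'C₁B)C₁`, and
`[Z, BC₁] − (BC₁)·([B₀, Z]C₁) = [Z, B]C₁`), then for `𝔈 = B₀𝔊₋`, which is `ad 𝔊₀`-stable once `𝔊₊ = ℂB₀`.
This is the E³-type skeleton `𝔰𝔩₂ ⊗ 1 ⊕ 1 ⊗ 𝔰` of Moonen–Zarhin (2.5) (multiplicity three).
[cite: MoonenZarhin1999LowDim, §2 (2.3), (2.5)] [cite: Gordon1997, §6] -/
theorem SymplecticThetaSix.lines_of_singleEigenvalue [FiniteDimensional ℂ M]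
    (𝔊 : Submodule ℂ (Module.End ℂ M))
    (hbr : ∀ Y ∈ 𝔊, ∀ Z ∈ 𝔊, Y * Z - Z * Y ∈ 𝔊) {T : Module.End ℂ M} (hT𝔊 : T ∈ 𝔊) (hTT : ∀ v, T (T v) = v)
    {P Q : Submodule ℂ M} (hP : ∀ x ∈ P, T x = x) (hQ : ∀ x ∈ Q, T x = -x)
    (hPmem : ∀ v, (2 : ℂ)⁻¹ • (v + T v) ∈ P) (hQmem : ∀ v, (2 : ℂ)⁻¹ • (v - T v) ∈ Q)
    (hirr : ∀ U : Submodule ℂ M, (∀ Z ∈ 𝔊, ∀ u ∈ U, Z u ∈ U) → U = ⊥ ∨ U = ⊤)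
    (hP3 : Module.finrank ℂ ↥P = 3)
    (hsingle : ∀ B ∈ 𝔊, (∀ p ∈ P, B p = 0) → (∀ v, B v ∈ P) → ∀ C ∈ 𝔊, (∀ q ∈ Q, C q = 0) →
      (∀ v, C v ∈ Q) → ∃ t : ℂ, ∀ p ∈ P, ((B * C - t • 1) ^ 3 : Module.End ℂ M) p = 0)
    {B₀ C₁ : Module.End ℂ M} (hB₀𝔊 : B₀ ∈ 𝔊) (hB₀P : ∀ p ∈ P, B₀ p = 0) (hB₀im : ∀ v, B₀ v ∈ P)
    (hC₁𝔊 : C₁ ∈ 𝔊) (hC₁Q : ∀ q ∈ Q, C₁ q = 0) (hC₁im : ∀ v, C₁ v ∈ Q)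
    (hBC : ∀ p ∈ P, B₀ (C₁ p) = p) (hCB : ∀ q ∈ Q, C₁ (B₀ q) = q) :
    (∀ B ∈ 𝔊, (∀ p ∈ P, B p = 0) → (∀ v, B v ∈ P) →
        B = ((3 : ℂ)⁻¹ * LinearMap.trace ℂ M (B * C₁)) • B₀) ∧
      (∀ C ∈ 𝔊, (∀ q ∈ Q, C q = 0) → (∀ v, C v ∈ Q) →
        C = ((3 : ℂ)⁻¹ * LinearMap.trace ℂ M (B₀ * C)) • C₁) := by
  classical
  have hsplit : ∀ v : M, ∃ p ∈ P, ∃ q ∈ Q, v = p + q := fun v =>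
    ⟨_, hPmem v, _, hQmem v, by module⟩
  -- the spaces `𝔊₊`, `𝔊₋`
  let 𝒮 : Submodule ℂ (Module.End ℂ M) :=
    { carrier := {B | B ∈ 𝔊 ∧ (∀ p ∈ P, B p = 0) ∧ ∀ v, B v ∈ P}
      add_mem' := fun {a b} ha hb => ⟨add_mem ha.1 hb.1, fun p hp => by
          rw [LinearMap.add_apply, ha.2.1 p hp, hb.2.1 p hp, add_zero], fun v => add_mem (ha.2.2 v) (hb.2.2 v)⟩
      zero_mem' := ⟨zero_mem _, fun _ _ => rfl, fun _ => zero_mem _⟩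
      smul_mem' := fun c a ha => ⟨𝔊.smul_mem c ha.1, fun p hp => by
          rw [LinearMap.smul_apply, ha.2.1 p hp, smul_zero], fun v => P.smul_mem c (ha.2.2 v)⟩ }
  have hmem𝒮 : ∀ B, B ∈ 𝒮 ↔ B ∈ 𝔊 ∧ (∀ p ∈ P, B p = 0) ∧ ∀ v, B v ∈ P := fun B => Iff.rfl
  let 𝒞 : Submodule ℂ (Module.End ℂ M) :=
    { carrier := {C | C ∈ 𝔊 ∧ (∀ q ∈ Q, C q = 0) ∧ ∀ v, C v ∈ Q}
      add_mem' := fun {a b} ha hb => ⟨add_mem ha.1 hb.1, fun q hq => by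
          rw [LinearMap.add_apply, ha.2.1 q hq, hb.2.1 q hq, add_zero], fun v => add_mem (ha.2.2 v) (hb.2.2 v)⟩
      zero_mem' := ⟨zero_mem _, fun _ _ => rfl, fun _ => zero_mem _⟩
      smul_mem' := fun c a ha => ⟨𝔊.smul_mem c ha.1, fun q hq => by
          rw [LinearMap.smul_apply, ha.2.1 q hq, smul_zero], fun v => Q.smul_mem c (ha.2.2 v)⟩ }
  have hmem𝒞 : ∀ C, C ∈ 𝒞 ↔ C ∈ 𝔊 ∧ (∀ q ∈ Q, C q = 0) ∧ ∀ v, C v ∈ Q := fun C => Iff.rfl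
  have hB₀𝒮 : B₀ ∈ 𝒮 := ⟨hB₀𝔊, hB₀P, hB₀im⟩
  have hC₁𝒞 : C₁ ∈ 𝒞 := ⟨hC₁𝔊, hC₁Q, hC₁im⟩
  have hSS : ∀ B ∈ 𝒮, ∀ B' ∈ 𝒮, B * B' = 0 := fun B hB B' hB' => by
    ext v; exact hB.2.1 _ (hB'.2.2 v)
  have hCC : ∀ C ∈ 𝒞, ∀ C' ∈ 𝒞, C * C' = 0 := fun C hC C' hC' => by
    ext v; exact hC.2.1 _ (hC'.2.2 v)
  -- brackets with `𝔊₀`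
  have hbrS : ∀ Z ∈ 𝔊, (∀ p ∈ P, Z p ∈ P) → (∀ q ∈ Q, Z q ∈ Q) → ∀ B ∈ 𝒮, Z * B - B * Z ∈ 𝒮 :=
    fun Z hZ hZP _ B hB => ⟨hbr Z hZ B hB.1, fun p hp => by
      rw [LinearMap.sub_apply, Module.End.mul_apply, Module.End.mul_apply, hB.2.1 p hp, map_zero,
        hB.2.1 _ (hZP p hp), sub_zero], fun v => sub_mem (hZP _ (hB.2.2 v)) (hB.2.2 _)⟩
  have hbrC : ∀ Z ∈ 𝔊, (∀ p ∈ P, Z p ∈ P) → (∀ q ∈ Q, Z q ∈ Q) → ∀ C ∈ 𝒞, Z * C - C * Z ∈ 𝒞 :=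
    fun Z hZ _ hZQ C hC => ⟨hbr Z hZ C hC.1, fun q hq => by
      rw [LinearMap.sub_apply, Module.End.mul_apply, Module.End.mul_apply, hC.2.1 q hq, map_zero,
        hC.2.1 _ (hZQ q hq), sub_zero], fun v => sub_mem (hZQ _ (hC.2.2 v)) (hC.2.2 _)⟩
  -- Jordan identities
  have hjordS : ∀ B ∈ 𝒮, ∀ B' ∈ 𝒮, ∀ C ∈ 𝒞, B * C * B' + B' * C * B ∈ 𝒮 := fun B hB B' hB' C hC => by
    have e : B * C * B' + B' * C * B = (B * C - C * B) * B' - B' * (B * C - C * B) := by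
      rw [show (B * C - C * B) * B' - B' * (B * C - C * B) = B * C * B' - C * (B * B') - (B' * B) * C + B' * C * B
        by noncomm_ring, hSS B hB B' hB', hSS B' hB' B hB]
      noncomm_ring
    refine ⟨by rw [e]; exact hbr _ (hbr B hB.1 C hC.1) B' hB'.1, fun p hp => by
      rw [LinearMap.add_apply, Module.End.mul_apply, Module.End.mul_apply, hB'.2.1 p hp, map_zero, map_zero,
        Module.End.mul_apply, Module.End.mul_apply, hB.2.1 p hp, map_zero, map_zero, add_zero],
      fun v => add_mem (hB.2.2 _) (hB'.2.2 _)⟩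
  have hjordC : ∀ C ∈ 𝒞, ∀ C' ∈ 𝒞, ∀ B ∈ 𝒮, C * B * C' + C' * B * C ∈ 𝒞 := fun C hC C' hC' B hB => by
    have e : C * B * C' + C' * B * C = -((B * C - C * B) * C' - C' * (B * C - C * B)) := by
      rw [show (B * C - C * B) * C' - C' * (B * C - C * B) = B * (C * C') - C * B * C' - C' * B * C + C' * C * B
        by noncomm_ring, hCC C hC C' hC', hCC C' hC' C hC]
      noncomm_ring
    refine ⟨by rw [e]; exact Submodule.neg_mem _ (hbr _ (hbr B hB.1 C hC.1) C' hC'.1), fun q hq => by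
      rw [LinearMap.add_apply, Module.End.mul_apply, Module.End.mul_apply, hC'.2.1 q hq, map_zero, map_zero,
        Module.End.mul_apply, Module.End.mul_apply, hC.2.1 q hq, map_zero, map_zero, add_zero],
      fun v => add_mem (hC.2.2 _) (hC'.2.2 _)⟩
  -- the projection `π = B₀ C₁`
  have hπP : ∀ p ∈ P, (B₀ * C₁) p = p := fun p hp => hBC p hp
  -- two operator identities from the unit relations
  have hF1 : ∀ Z : Module.End ℂ M, (∀ q ∈ Q, Z q ∈ Q) → C₁ * B₀ * Z * C₁ = Z * C₁ := fun Z hZQ => by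
    ext v
    simp only [Module.End.mul_apply]
    exact hCB _ (hZQ _ (hC₁im v))
  have hF2 : ∀ Z : Module.End ℂ M, (∀ p ∈ P, Z p ∈ P) → (∀ q ∈ Q, Z q ∈ Q) →
      C₁ * Z * B₀ * C₁ = C₁ * Z := fun Z hZP hZQ => by
    ext v
    obtain ⟨p, hp, q, hq, rfl⟩ := hsplit v
    simp only [Module.End.mul_apply, map_add, hC₁Q q hq, map_zero, add_zero, hBC p hp, hC₁Q _ (hZQ q hq)]
  ------------------------------------------------------------------
  -- Part 1: `𝔊₊ = ℂ B₀`, by the collapse lemma for `𝔈 = 𝔊₊ C₁`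
  ------------------------------------------------------------------
  set 𝔖 : Submodule ℂ (Module.End ℂ M) := 𝒮.map (LinearMap.mulRight ℂ C₁) with h𝔖
  have hmem𝔖 : ∀ X, X ∈ 𝔖 ↔ ∃ B ∈ 𝒮, B * C₁ = X := fun X => by
    simp only [h𝔖, Submodule.mem_map, LinearMap.mulRight_apply]
  have h𝔖of : ∀ B ∈ 𝒮, B * C₁ ∈ 𝔖 := fun B hB => (hmem𝔖 _).2 ⟨B, hB, rfl⟩
  have hcol1 := SymplecticThetaSix.corner_eq_smul_of_singleEigenvalue 𝔊 hbr hT𝔊 hTT hP hQ hPmem hQmem hirr hP3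
    𝔖 (h𝔖of B₀ hB₀𝒮) hπP
    (fun X hX q hq => by
      obtain ⟨B, hB, rfl⟩ := (hmem𝔖 X).1 hX
      rw [Module.End.mul_apply, hC₁Q q hq, map_zero])
    (fun X hX v => by
      obtain ⟨B, hB, rfl⟩ := (hmem𝔖 X).1 hX
      exact hB.2.2 _)
    (fun X hX X' hX' => by
      obtain ⟨B, hB, rfl⟩ := (hmem𝔖 X).1 hX
      obtain ⟨B', hB', rfl⟩ := (hmem𝔖 X').1 hX'
      rw [show B * C₁ * (B' * C₁) + B' * C₁ * (B * C₁) = (B * C₁ * B' + B' * C₁ * B) * C₁ by noncomm_ring]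
      exact h𝔖of _ (hjordS B hB B' hB' C₁ hC₁𝒞))
    (fun X hX => by
      obtain ⟨B, hB, rfl⟩ := (hmem𝔖 X).1 hX
      exact hsingle B hB.1 hB.2.1 hB.2.2 C₁ hC₁𝔊 hC₁Q hC₁im)
    (fun Z hZ hZP hZQ X hX => by
      obtain ⟨B, hB, rfl⟩ := (hmem𝔖 X).1 hX
      refine ⟨(B₀ * Z - Z * B₀) * C₁, h𝔖of _ ?_, ?_⟩
      · rw [show B₀ * Z - Z * B₀ = -(Z * B₀ - B₀ * Z) by abel]
        exact 𝒮.neg_mem (hbrS Z hZ hZP hZQ B₀ hB₀𝒮)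
      · have e : Z * (B * C₁) - B * C₁ * Z - B * C₁ * ((B₀ * Z - Z * B₀) * C₁) = (Z * B - B * Z) * C₁ := by
          rw [show B * C₁ * ((B₀ * Z - Z * B₀) * C₁) = B * (C₁ * B₀ * Z * C₁) - B * (C₁ * Z * B₀ * C₁)
            by noncomm_ring, hF1 Z hZQ, hF2 Z hZP hZQ]
          noncomm_ring
        rw [e]
        exact h𝔖of _ (hbrS Z hZ hZP hZQ B hB))
  have hpart1 : ∀ B ∈ 𝒮, B = ((3 : ℂ)⁻¹ * LinearMap.trace ℂ M (B * C₁)) • B₀ := by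
    intro B hB
    have h := hcol1 (B * C₁) (h𝔖of B hB)
    rw [← smul_mul_assoc, ← sub_eq_zero, ← sub_mul] at h
    rw [← sub_eq_zero]
    ext v
    obtain ⟨p, hp, q, hq, rfl⟩ := hsplit v
    have hD : B - ((3 : ℂ)⁻¹ * LinearMap.trace ℂ M (B * C₁)) • B₀ ∈ 𝒮 := sub_mem hB (𝒮.smul_mem _ hB₀𝒮)
    have hq' := congrArg (fun f : Module.End ℂ M => f (B₀ q)) h
    simp only [Module.End.mul_apply, hCB q hq, LinearMap.zero_apply] at hq'
    rw [map_add, hD.2.1 p hp, zero_add, hq', LinearMap.zero_apply]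
  ------------------------------------------------------------------
  -- Part 2: `𝔊₋ = ℂ C₁`, by the collapse lemma for `𝔈 = B₀ 𝔊₋`
  ------------------------------------------------------------------
  set ℭ : Submodule ℂ (Module.End ℂ M) := 𝒞.map (LinearMap.mulLeft ℂ B₀) with hℭ
  have hmemℭ : ∀ X, X ∈ ℭ ↔ ∃ C ∈ 𝒞, B₀ * C = X := fun X => by
    simp only [hℭ, Submodule.mem_map, LinearMap.mulLeft_apply]
  have hℭof : ∀ C ∈ 𝒞, B₀ * C ∈ ℭ := fun C hC => (hmemℭ _).2 ⟨C, hC, rfl⟩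
  have hcol2 := SymplecticThetaSix.corner_eq_smul_of_singleEigenvalue 𝔊 hbr hT𝔊 hTT hP hQ hPmem hQmem hirr hP3
    ℭ (hℭof C₁ hC₁𝒞) hπP
    (fun X hX q hq => by
      obtain ⟨C, hC, rfl⟩ := (hmemℭ X).1 hX
      rw [Module.End.mul_apply, hC.2.1 q hq, map_zero])
    (fun X hX v => by
      obtain ⟨C, hC, rfl⟩ := (hmemℭ X).1 hX
      exact hB₀im _)
    (fun X hX X' hX' => by
      obtain ⟨C, hC, rfl⟩ := (hmemℭ X).1 hX
      obtain ⟨C', hC', rfl⟩ := (hmemℭ X').1 hX'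
      rw [show B₀ * C * (B₀ * C') + B₀ * C' * (B₀ * C) = B₀ * (C * B₀ * C' + C' * B₀ * C) by noncomm_ring]
      exact hℭof _ (hjordC C hC C' hC' B₀ hB₀𝒮))
    (fun X hX => by
      obtain ⟨C, hC, rfl⟩ := (hmemℭ X).1 hX
      exact hsingle B₀ hB₀𝔊 hB₀P hB₀im C hC.1 hC.2.1 hC.2.2)
    (fun Z hZ hZP hZQ X hX => by
      obtain ⟨C, hC, rfl⟩ := (hmemℭ X).1 hX
      refine ⟨0, zero_mem _, ?_⟩
      set c := (3 : ℂ)⁻¹ * LinearMap.trace ℂ M ((Z * B₀ - B₀ * Z) * C₁) with hc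
      have hZB₀ := hpart1 _ (hbrS Z hZ hZP hZQ B₀ hB₀𝒮)
      have e : Z * (B₀ * C) - B₀ * C * Z - B₀ * C * 0 = B₀ * (Z * C - C * Z + c • C) := by
        rw [mul_zero, sub_zero, mul_add, mul_smul_comm, ← smul_mul_assoc, ← hZB₀]
        noncomm_ring
      rw [e]
      exact hℭof _ (add_mem (hbrC Z hZ hZP hZQ C hC) (𝒞.smul_mem _ hC)))
  refine ⟨fun B hB𝔊 hBP hBim => hpart1 B ⟨hB𝔊, hBP, hBim⟩, fun C hC𝔊 hCQ hCim => ?_⟩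
  have h := hcol2 (B₀ * C) (hℭof C ⟨hC𝔊, hCQ, hCim⟩)
  rw [← mul_smul_comm, ← sub_eq_zero, ← mul_sub] at h
  rw [← sub_eq_zero]
  ext v
  have hv : (C - ((3 : ℂ)⁻¹ * LinearMap.trace ℂ M (B₀ * C)) • C₁) v ∈ Q :=
    sub_mem (hCim v) (Q.smul_mem _ (hC₁im v))
  have h0 := congrArg (fun f : Module.End ℂ M => f v) h
  simp only [Module.End.mul_apply, LinearMap.zero_apply] at h0
  rw [LinearMap.zero_apply, ← hCB _ hv, h0, map_zero]

end Skeleton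

end HodgeStructure

end Literature.AlgebraicGeometry.Motives
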